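import Mathlib

/-!
# Finite Fourier inversion with a prescribed isotypic component (T3.5, seat t3-p1 g2)

The elementary core of the lead's complex placement of R-B (INBOX L6576 (1)–(2)): for a fixed
conductor the vector of twisted `L`-values `(L(½, χ ε))_ε`, `ε` running over the characters of a
finite abelian group `Cl′` (the conductor-`𝔩ⁿ` ring class group), is the Fourier transform of a
function `g` on `Cl′` (a CM-point sum), so ONE non-zero value of `g` gives SOME `ε` with
`L(½, χ ε) ≠ 0` (finite Fourier inversion, `exists_char_sum_ne_zero`), and the characters
extending a prescribed character `ψ₀` of a subgroup `H ≤ Cl′` (the torsion part `Δ`; the route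
needs the TRIVIAL branch, `ψ₀ = 1`, the anticyclotomic characters `ν ∈ Ξ_𝔩`) see exactly the
`ψ₀`-isotypic projection `a ↦ ∑_{h ∈ H} ψ₀(h) g(a h)` of `g` (`isotypic_iff`,
`trivial_branch_iff`).

Everything is stated for a finite commutative group `G` (multiplicative) with characters
`G →* ℂˣ`; the orthogonality relations are proved from scratch (characters of a finite abelian
group separate points: Mathlib `CommGroup.exists_apply_ne_one_of_hasEnoughRootsOfUnity`).
This file stands BESIDE `Summits/Ventures/HodgeRepro/Tier3FourierInversion.lean` (seat t3-p4 g2,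
the additive `AddChar α ℂ` form of the same two statements, landed first): it is the multiplicative
`G →* ℂˣ` form, with the trivial-branch corollary and the inverse-convention variant.

Convention. With `ε(a h) = ε(a) ψ₀(h)` for `ε` extending `ψ₀`, the isotypic sum that pairs with
such `ε` is `∑_h ψ₀(h) g(a h)`; the sum `∑_h ψ₀(h⁻¹) g(a h)` pairs with the characters extending
`ψ₀⁻¹` (`isotypic_iff_inv`).  The two agree when `ψ₀ = ψ₀⁻¹`, in particular on the trivial
branch.
-/

set_option autoImplicit false

namespace HodgeRepro.T3P1.FourierInversion

open Finset

variable {G : Type*} [CommGroup G] [Fintype G]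

/-- Orthogonality, summed over the group: a non-trivial character of a finite group sums to
zero over the group. -/
theorem sum_apply_eq_zero_of_ne_one {χ : G →* ℂˣ} (hχ : χ ≠ 1) : ∑ a, (χ a : ℂ) = 0 := by
  obtain ⟨a₀, ha₀⟩ : ∃ a₀, χ a₀ ≠ 1 := by
    by_contra h
    push Not at h
    exact hχ (MonoidHom.ext h)
  have h : ∑ a, (χ a : ℂ) = (χ a₀ : ℂ) * ∑ a, (χ a : ℂ) := by
    rw [Finset.mul_sum]
    exact (Fintype.sum_equiv (Equiv.mulLeft a₀) _ _ (fun a => by simp [Units.val_mul])).symm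
  have h' : ((χ a₀ : ℂ) - 1) * ∑ a, (χ a : ℂ) = 0 := by linear_combination -h
  rcases mul_eq_zero.1 h' with h1 | h1
  · exact absurd (Units.val_eq_one.1 (sub_eq_zero.1 h1)) ha₀
  · exact h1

/-- Orthogonality, summed over the characters: for `a ≠ 1` the values `χ a` of all characters
`χ : G →* ℂˣ` sum to zero. -/
theorem sum_char_apply_eq_zero [Fintype (G →* ℂˣ)] {a : G} (ha : a ≠ 1) :
    ∑ χ : G →* ℂˣ, (χ a : ℂ) = 0 := by
  obtain ⟨χ₀, hχ₀⟩ := CommGroup.exists_apply_ne_one_of_hasEnoughRootsOfUnity G ℂ ha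
  have h : ∑ χ : G →* ℂˣ, (χ a : ℂ) = (χ₀ a : ℂ) * ∑ χ : G →* ℂˣ, (χ a : ℂ) := by
    rw [Finset.mul_sum]
    exact (Fintype.sum_equiv (Equiv.mulLeft χ₀) _ _ (fun χ => by simp [Units.val_mul])).symm
  have h' : ((χ₀ a : ℂ) - 1) * ∑ χ : G →* ℂˣ, (χ a : ℂ) = 0 := by linear_combination -h
  rcases mul_eq_zero.1 h' with h1 | h1
  · exact absurd (Units.val_eq_one.1 (sub_eq_zero.1 h1)) hχ₀
  · exact h1

/-- The sum of all characters at `a` is `card (G →* ℂˣ)` if `a = 1` and `0` otherwise. -/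
theorem sum_char_apply_eq_ite [Fintype (G →* ℂˣ)] [DecidableEq G] (a : G) :
    ∑ χ : G →* ℂˣ, (χ a : ℂ) = if a = 1 then (Fintype.card (G →* ℂˣ) : ℂ) else 0 := by
  split_ifs with ha
  · subst ha; simp
  · exact sum_char_apply_eq_zero ha

/-- (A) Finite Fourier inversion: a non-zero function `g : G → ℂ` on a finite abelian group has a
non-zero Fourier coefficient — some character `ε : G →* ℂˣ` has `∑ a, ε a * g a ≠ 0`. -/
theorem exists_char_sum_ne_zero (g : G → ℂ) (hg : g ≠ 0) :
    ∃ ε : G →* ℂˣ, ∑ a, (ε a : ℂ) * g a ≠ 0 := by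
  classical
  haveI : Fintype (G →* ℂˣ) := Fintype.ofFinite _
  by_contra hcon
  push Not at hcon
  obtain ⟨b, hb⟩ : ∃ b, g b ≠ 0 := Function.ne_iff.1 hg
  -- ∑_ε ε(b⁻¹) ∑_a ε(a) g(a) = ∑_a g(a) ∑_ε ε(a b⁻¹) = card · g(b)
  have key : ∑ ε : G →* ℂˣ, (ε b⁻¹ : ℂ) * ∑ a, (ε a : ℂ) * g a
      = (Fintype.card (G →* ℂˣ) : ℂ) * g b := by
    calc ∑ ε : G →* ℂˣ, (ε b⁻¹ : ℂ) * ∑ a, (ε a : ℂ) * g a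
        = ∑ a, g a * ∑ ε : G →* ℂˣ, (ε (a * b⁻¹) : ℂ) := by
          simp only [Finset.mul_sum, map_mul, Units.val_mul]
          rw [Finset.sum_comm]
          refine Finset.sum_congr rfl fun a _ => Finset.sum_congr rfl fun ε _ => by ring
      _ = ∑ a, g a * (if a * b⁻¹ = 1 then (Fintype.card (G →* ℂˣ) : ℂ) else 0) := by
          simp only [sum_char_apply_eq_ite]
      _ = (Fintype.card (G →* ℂˣ) : ℂ) * g b := by
          simp only [mul_inv_eq_one, mul_ite, mul_zero]
          rw [Finset.sum_ite_eq' Finset.univ b]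
          simp [mul_comm]
  have hzero : ∑ ε : G →* ℂˣ, (ε b⁻¹ : ℂ) * ∑ a, (ε a : ℂ) * g a = 0 := by
    simp [hcon]
  rw [key] at hzero
  rcases mul_eq_zero.1 hzero with h1 | h1
  · exact absurd h1 (by exact_mod_cast Fintype.card_ne_zero)
  · exact hb h1

/-- For a character `ε` extending `ψ₀` on `H`, `|H| · ∑_a ε(a) g(a) = ∑_a ε(a) ∑_{h ∈ H} ψ₀(h) g(a h)`. -/
theorem card_mul_sum_eq_sum_isotypic (H : Subgroup G) [Fintype H] (ψ₀ : H →* ℂˣ) (ε : G →* ℂˣ)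
    (hε : ∀ h : H, ε h = ψ₀ h) (g : G → ℂ) :
    (Fintype.card H : ℂ) * ∑ a, (ε a : ℂ) * g a
      = ∑ a, (ε a : ℂ) * ∑ h : H, (ψ₀ h : ℂ) * g (a * h) := by
  have step : ∀ h : H, ∑ a, (ε a : ℂ) * g a = (ψ₀ h : ℂ) * ∑ a, (ε a : ℂ) * g (a * h) := by
    intro h
    rw [Finset.mul_sum]
    refine (Fintype.sum_equiv (Equiv.mulRight (h : G)) _ _ (fun a => ?_)).symm
    simp only [Equiv.coe_mulRight, map_mul, Units.val_mul, hε h]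
    ring
  calc (Fintype.card H : ℂ) * ∑ a, (ε a : ℂ) * g a
      = ∑ h : H, ∑ a, (ε a : ℂ) * g a := by
          rw [Finset.sum_const, Finset.card_univ, nsmul_eq_mul]
    _ = ∑ h : H, (ψ₀ h : ℂ) * ∑ a, (ε a : ℂ) * g (a * h) := Finset.sum_congr rfl fun h _ => step h
    _ = ∑ a, (ε a : ℂ) * ∑ h : H, (ψ₀ h : ℂ) * g (a * h) := by
          simp only [Finset.mul_sum]
          rw [Finset.sum_comm]
          refine Finset.sum_congr rfl fun a _ => Finset.sum_congr rfl fun h _ => by ring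

/-- For any character `ε`, `∑_a ε(a) ∑_{h ∈ H} ψ₀(h) g(a h) = (∑_{h ∈ H} ψ₀(h) ε(h)⁻¹) · ∑_a ε(a) g(a)`. -/
theorem sum_char_isotypic_eq (H : Subgroup G) [Fintype H] (ψ₀ : H →* ℂˣ) (ε : G →* ℂˣ)
    (g : G → ℂ) :
    ∑ a, (ε a : ℂ) * ∑ h : H, (ψ₀ h : ℂ) * g (a * h)
      = (∑ h : H, (ψ₀ h : ℂ) * (ε h : ℂ)⁻¹) * ∑ a, (ε a : ℂ) * g a := by
  have step : ∀ h : H, ∑ a, (ε a : ℂ) * g (a * h) = (ε h : ℂ)⁻¹ * ∑ a, (ε a : ℂ) * g a := by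
    intro h
    rw [Finset.mul_sum]
    refine Fintype.sum_equiv (Equiv.mulRight (h : G)) _ _ (fun a => ?_)
    simp only [Equiv.coe_mulRight, map_mul, Units.val_mul]
    have hu : (ε h : ℂ) ≠ 0 := Units.ne_zero _
    field_simp
  calc ∑ a, (ε a : ℂ) * ∑ h : H, (ψ₀ h : ℂ) * g (a * h)
      = ∑ h : H, (ψ₀ h : ℂ) * ∑ a, (ε a : ℂ) * g (a * h) := by
          simp only [Finset.mul_sum]
          rw [Finset.sum_comm]
          refine Finset.sum_congr rfl fun h _ => Finset.sum_congr rfl fun a _ => by ring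
    _ = ∑ h : H, (ψ₀ h : ℂ) * ((ε h : ℂ)⁻¹ * ∑ a, (ε a : ℂ) * g a) :=
          Finset.sum_congr rfl fun h _ => by rw [step h]
    _ = (∑ h : H, (ψ₀ h : ℂ) * (ε h : ℂ)⁻¹) * ∑ a, (ε a : ℂ) * g a := by
          rw [Finset.sum_mul]
          refine Finset.sum_congr rfl fun h _ => by ring

/-- (B) The prescribed isotypic component: for a subgroup `H ≤ G` and a character `ψ₀` of `H`, the
`ψ₀`-isotypic projection `a ↦ ∑_{h ∈ H} ψ₀(h) g(a h)` of `g` is non-zero somewhere if and only if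
some character `ε` of `G` extending `ψ₀` has `∑ a, ε a * g a ≠ 0`. -/
theorem isotypic_iff (H : Subgroup G) [Fintype H] (ψ₀ : H →* ℂˣ) (g : G → ℂ) :
    (∃ a : G, ∑ h : H, (ψ₀ h : ℂ) * g (a * h) ≠ 0)
      ↔ ∃ ε : G →* ℂˣ, (∀ h : H, ε h = ψ₀ h) ∧ ∑ a, (ε a : ℂ) * g a ≠ 0 := by
  constructor
  · rintro ⟨a₀, ha₀⟩
    -- Fourier inversion for the isotypic projection `T`
    set T : G → ℂ := fun a => ∑ h : H, (ψ₀ h : ℂ) * g (a * h) with hT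
    have hT0 : T ≠ 0 := fun h => ha₀ (by simpa [hT] using congrFun h a₀)
    obtain ⟨ε, hε⟩ := exists_char_sum_ne_zero T hT0
    rw [show ∑ a, (ε a : ℂ) * T a = ∑ a, (ε a : ℂ) * ∑ h : H, (ψ₀ h : ℂ) * g (a * h) from rfl,
      sum_char_isotypic_eq] at hε
    refine ⟨ε, ?_, right_ne_zero_of_mul hε⟩
    -- the inner product of `ψ₀` with `ε|_H` is non-zero, so `ε|_H = ψ₀`
    have hinner : ∑ h : H, (ψ₀ h : ℂ) * (ε h : ℂ)⁻¹ ≠ 0 := left_ne_zero_of_mul hε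
    set χ : H →* ℂˣ := ψ₀ * (ε.restrict H)⁻¹ with hχ
    have hsum : ∑ h : H, (χ h : ℂ) = ∑ h : H, (ψ₀ h : ℂ) * (ε h : ℂ)⁻¹ := by
      refine Finset.sum_congr rfl fun h _ => ?_
      simp [hχ, MonoidHom.restrict_apply, Units.val_inv_eq_inv_val]
    have hχ1 : χ = 1 := by
      by_contra hne
      exact hinner (hsum ▸ sum_apply_eq_zero_of_ne_one hne)
    intro h
    have := congrArg (fun φ : H →* ℂˣ => φ h) hχ1
    simp only [hχ, MonoidHom.mul_apply, MonoidHom.inv_apply, MonoidHom.restrict_apply,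
      MonoidHom.one_apply] at this
    exact (mul_inv_eq_one.1 this).symm
  · rintro ⟨ε, hε, hS⟩
    by_contra hcon
    push Not at hcon
    have h := card_mul_sum_eq_sum_isotypic H ψ₀ ε hε g
    simp only [hcon, mul_zero, Finset.sum_const_zero] at h
    rcases mul_eq_zero.1 h with h1 | h1
    · exact absurd h1 (by exact_mod_cast Fintype.card_ne_zero)
    · exact hS h1

/-- The trivial branch (the route's case, `ψ₀ = 1`): the `H`-averages `a ↦ ∑_{h ∈ H} g(a h)` are
not all zero iff some character of `G` trivial on `H` has a non-zero Fourier coefficient. -/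
theorem trivial_branch_iff (H : Subgroup G) [Fintype H] (g : G → ℂ) :
    (∃ a : G, ∑ h : H, g (a * h) ≠ 0)
      ↔ ∃ ε : G →* ℂˣ, (∀ h : H, ε h = 1) ∧ ∑ a, (ε a : ℂ) * g a ≠ 0 := by
  simpa using isotypic_iff H 1 g

/-- The same statement with the sum `∑_{h ∈ H} ψ₀(h⁻¹) g(a h)`: it sees the characters extending
`ψ₀⁻¹` (for `ψ₀ = ψ₀⁻¹`, e.g. the trivial branch, the two readings agree). -/
theorem isotypic_iff_inv (H : Subgroup G) [Fintype H] (ψ₀ : H →* ℂˣ) (g : G → ℂ) :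
    (∃ a : G, ∑ h : H, (ψ₀ h⁻¹ : ℂ) * g (a * h) ≠ 0)
      ↔ ∃ ε : G →* ℂˣ, (∀ h : H, ε h = (ψ₀ h)⁻¹) ∧ ∑ a, (ε a : ℂ) * g a ≠ 0 := by
  have := isotypic_iff H ψ₀⁻¹ g
  simpa [MonoidHom.inv_apply, map_inv] using this

end HodgeRepro.T3P1.FourierInversion
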